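import Summits.Schanuel.Schanuel.Theorems.SoloInformedFloorTorsion
import Literature.NumberTheory.Transcendental.BWMain

/-!
# The Brownawell–Waldschmidt disjunction at the torsion floor (soloist Proposition T′)

Soloist file (`solo-Schanuel-informed`, residency session s12, 2026-08-19), sequel of
`SoloInformedFloorTorsion` (Proposition T: `π/e ∉ ℚ ⟺ e^{ie}` is not a root of unity; Baker's
dichotomy `e^e ∉ ℚ̄ ∨ (1, e, π  ℚ̄-linearly independent)`).  It adds the one other unconditional
statement the known engines leave at that floor, read off the tree's PROVED Brownawell–Waldschmidt
theorem (`Literature.NumberTheory.Transcendental.BrownawellWaldschmidt.brownawell_waldschmidt`,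
Gel'fond's method, [Baker1975, Thm 12.2]):

* `transcendental_cexp_mul_I_or` — for real `θ ≠ 0` with `θ ∈ ℚ(e)` (e.g. `θ = e`, `θ = 1/e`):
  `e^{iθ}` or `e^{−θ²}` is transcendental.  (Grid `x = (iθ, 1)`, `y = (1, iθ)`: the exponentials are
  `e^{iθ}, e^{−θ²}, e, e^{iθ}`; if the first two were algebraic the generated field would be
  algebraic over `ℚ(e)`, of transcendence degree `1 < 2`.)
* `transcendental_cexp_exp_one_mul_I_or` : `e^{ie}` or `e^{−e²}` is transcendental (compare
  "`e^e` or `e^{e²}`", Schneider's eighth problem, [Baker1975, p. 111]);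
  `transcendental_cexp_inv_exp_one_mul_I_or` : `e^{i/e}` or `e^{−1/e²}` is transcendental.

## Reading (atlas §1 F4′)

Every unconditional statement at the floor below `e ⟂ π` is a DISJUNCTION with an escape through an
undecidable number (`e^e` for Baker, `e^{e²}` for Brownawell–Waldschmidt): the grid and linear-form
engines absorb the coupling constant `ie` (additive coordinate of the point `(ie, e^{ie})` = `i ×`
multiplicative coordinate of the point `(1, e)`) only as a grid parameter, and never single out
`e^{ie}` — whose non-torsion (`⟺ π/e ∉ ℚ`) is what `SC(2)` at `(1, iπ)` asserts at the bottom.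

## References

* [Baker1975] A. Baker, *Transcendental Number Theory*, Cambridge Univ. Press 1975, Ch. 12,
  Theorem 12.2 and p. 111.
-/

noncomputable section

open Complex IntermediateField
open Literature.NumberTheory.Transcendental (SchanuelRank)
open Literature.NumberTheory.Transcendental.BrownawellWaldschmidt (brownawell_waldschmidt)
open Literature.NumberTheory.Transcendental.Philippon1986_criterion (trdeg_adjoin_range_le)
open Literature.Barriers.Schanuel (trdeg_mono trdeg_adjoin_union_eq_of_isAlgebraic isAlgebraic_I)

namespace Summit.Schanuel.Schanuel.Theorems

/-- **Brownawell–Waldschmidt at the floor.** For real `θ ≠ 0` with `θ ∈ ℚ(e)`: `e^{iθ}` or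
`e^{−θ²}` is transcendental (grid `x = (iθ, 1)`, `y = (1, iθ)` of the tree's proved
Brownawell–Waldschmidt theorem [Baker1975, Thm 12.2]). -/
theorem transcendental_cexp_mul_I_or {θ : ℝ} (hθ : θ ≠ 0)
    (hθe : (θ : ℂ) ∈ adjoin ℚ ({cexp 1} : Set ℂ)) :
    Transcendental ℚ (cexp ((θ : ℂ) * I)) ∨ Transcendental ℚ (cexp (-(θ : ℂ) ^ 2)) := by
  by_contra hcon
  rw [not_or] at hcon
  obtain ⟨h1, h2⟩ := hcon
  simp only [Transcendental, not_not] at h1 h2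
  set t : ℂ := (θ : ℂ) * I with ht
  have ht2 : t * t = -(θ : ℂ) ^ 2 := by
    rw [ht]; ring_nf; rw [Complex.I_sq]; ring
  have hy : LinearIndependent ℚ ![(1 : ℂ), t] := by
    have h' := linearIndependent_re_imI one_ne_zero hθ
    rwa [Complex.ofReal_one] at h'
  have hx : LinearIndependent ℚ ![t, 1] := by
    refine LinearIndependent.pair_iff.mpr fun s r hsr => ?_
    have h' := LinearIndependent.pair_iff.mp hy r s (by rw [add_comm]; exact hsr)
    exact ⟨h'.2, h'.1⟩
  have ha₁ : IsAlgebraic ℚ (cexp (![t, 1] 0 * ![(1 : ℂ), t] 0)) := by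
    simp only [Matrix.cons_val_zero, mul_one]; exact h1
  have ha₂ : IsAlgebraic ℚ (cexp (![t, 1] 0 * ![(1 : ℂ), t] 1)) := by
    simp only [Matrix.cons_val_zero, Matrix.cons_val_one, Matrix.cons_val_fin_one]
    rw [ht2]; exact h2
  have hBW := brownawell_waldschmidt ![t, 1] ![(1 : ℂ), t] hx hy ha₁ ha₂
  -- the generated field sits inside `ℚ(e)(i, e^{iθ}, e^{-θ²})`, of transcendence degree `≤ 1`
  set S : Set ℂ := Set.range ![cexp 1] with hS
  set T : Set ℂ := {I, cexp t, cexp (t * t)} with hT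
  have hTalg : ∀ x ∈ T, IsAlgebraic ℚ x := by
    rintro x (rfl | rfl | rfl)
    · exact isAlgebraic_I
    · exact h1
    · rw [ht2]; exact h2
  have he : cexp 1 ∈ adjoin ℚ (S ∪ T) := subset_adjoin ℚ _ (Or.inl ⟨0, rfl⟩)
  have hI : I ∈ adjoin ℚ (S ∪ T) := subset_adjoin ℚ _ (Or.inr (by simp [hT]))
  have het : cexp t ∈ adjoin ℚ (S ∪ T) := subset_adjoin ℚ _ (Or.inr (by simp [hT]))
  have hett : cexp (t * t) ∈ adjoin ℚ (S ∪ T) := subset_adjoin ℚ _ (Or.inr (by simp [hT]))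
  have hθ' : (θ : ℂ) ∈ adjoin ℚ (S ∪ T) :=
    (adjoin.mono ℚ _ _ (by rintro x rfl; exact Or.inl ⟨0, rfl⟩)) hθe
  have htm : t ∈ adjoin ℚ (S ∪ T) := mul_mem hθ' hI
  have hle : adjoin ℚ (Set.range ![t, 1] ∪ Set.range ![(1 : ℂ), t] ∪
      Set.range (fun p : Fin 2 × Fin 2 => cexp (![t, 1] p.1 * ![(1 : ℂ), t] p.2))) ≤
      adjoin ℚ (S ∪ T) := by
    rw [adjoin_le_iff]
    rintro w ((⟨i, rfl⟩ | ⟨i, rfl⟩) | ⟨⟨i, j⟩, rfl⟩)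
    · fin_cases i
      · exact htm
      · exact one_mem _
    · fin_cases i
      · exact one_mem _
      · exact htm
    · fin_cases i <;> fin_cases j <;>
        simp only [Fin.zero_eta, Fin.mk_one, Matrix.cons_val_zero, Matrix.cons_val_one,
          Matrix.cons_val_fin_one, mul_one, one_mul]
      · exact het
      · exact hett
      · exact he
      · exact het
  have h1' : Algebra.trdeg ℚ ↥(adjoin ℚ S) ≤ ((1 : ℕ) : Cardinal) := by
    rw [hS]
    exact trdeg_adjoin_range_le (F := ℚ) ![cexp 1]
  have htr := (trdeg_adjoin_union_eq_of_isAlgebraic S T hTalg).trans_le h1'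
  have h21 : ((2 : ℕ) : Cardinal) ≤ ((1 : ℕ) : Cardinal) := (hBW.trans (trdeg_mono hle)).trans htr
  have : (2 : ℕ) ≤ 1 := by exact_mod_cast h21
  omega

/-- **`e^{ie}` or `e^{−e²}` is transcendental** (unconditional; the transcendence of `e^{−e²}` is
that of `e^{e²}`). -/
theorem transcendental_cexp_exp_one_mul_I_or :
    Transcendental ℚ (cexp (cexp 1 * I)) ∨ Transcendental ℚ (cexp (-(cexp 1) ^ 2)) := by
  have h' := transcendental_cexp_mul_I_or (Real.exp_pos 1).ne'
    (by rw [Complex.ofReal_exp, Complex.ofReal_one]; exact subset_adjoin ℚ _ rfl)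
  rwa [Complex.ofReal_exp, Complex.ofReal_one] at h'

/-- **`e^{i/e}` or `e^{−1/e²}` is transcendental** (unconditional). -/
theorem transcendental_cexp_inv_exp_one_mul_I_or :
    Transcendental ℚ (cexp ((cexp 1)⁻¹ * I)) ∨ Transcendental ℚ (cexp (-((cexp 1)⁻¹) ^ 2)) := by
  have h' := transcendental_cexp_mul_I_or (inv_ne_zero (Real.exp_pos 1).ne')
    (by
      rw [Complex.ofReal_inv, Complex.ofReal_exp, Complex.ofReal_one]
      exact inv_mem (subset_adjoin ℚ _ rfl))
  rwa [Complex.ofReal_inv, Complex.ofReal_exp, Complex.ofReal_one] at h'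

/-- **The unconditional disjunctions at the floor, side by side**: Baker's
(`e^e ∉ ℚ̄ ∨ π/e ∉ ℚ̄`), Brownawell–Waldschmidt's (`e^{ie} ∉ ℚ̄ ∨ e^{−e²} ∉ ℚ̄`), and what
`SchanuelRank 2` asserts instead (`e^{ie} ∉ ℚ̄` outright). -/
theorem floor_disjunctions :
    (Transcendental ℚ (Real.exp (Real.exp 1)) ∨ Transcendental ℚ (Real.pi / Real.exp 1)) ∧
      (Transcendental ℚ (cexp (cexp 1 * I)) ∨ Transcendental ℚ (cexp (-(cexp 1) ^ 2))) ∧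
      (SchanuelRank 2 → Transcendental ℚ (cexp (cexp 1 * I))) :=
  ⟨transcendental_exp_exp_one_or.imp_right fun h => h.2.1, transcendental_cexp_exp_one_mul_I_or,
    transcendental_cexp_exp_one_mul_I_of_schanuelRank_two⟩

end Summit.Schanuel.Schanuel.Theorems

end
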